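import Literature.MathematicalPhysics.QuantumFieldTheory.Balaban1983to89.B6Prop26Census2136KLevelV1
import Literature.MathematicalPhysics.QuantumFieldTheory.Balaban1983to89.B6KLevelCensusBookkeepingV1
import Literature.MathematicalPhysics.QuantumFieldTheory.Balaban1983to89.B6HolderPairMemberV1
import HarnessLib

/-!
# `Balaban1983to89.B6Prop26Census2137KLevelV1` — T. Bałaban, *Propagators and renormalization transformations for lattice gauge theories. II*,
Comm. Math. Phys. **96** (1984) 223–250 [Balaban1984PropagatorsII], p. 247 **PROPOSITION 2.6, THE HÖLDER ENTRIES (2.137) — THE SECOND CONJUNCT OF THE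
VERBATIM CENSUS TYPING `…B6.Prop26Printed` ON THE GENUINE k-LEVEL V1 FAMILY, MODULO ITS k-LEVEL INPUTS DISPLAYED** (B6-CLOSURE §5 item 21, second file;
fold owner r03): the census slot `h1 J α ζ` (the larger of `‖ζ∇GJ‖_α` and `‖ζG∇*J‖_α`, readings of `B6Prop26Census2136KLevelV1.kG`) is bounded by
`C(α)(Lʲη)^{1−α}(‖ζ‖^ξ_α + |ζ|)e^{−δ₃d(y,y′)}|J|` with ONE threshold `M₁ ≤ M` chosen BEFORE the Hölder exponent, from four k-level inputs of the same
shape as the files in flight — the pair majorants `HasMajorant (P_{x,x′}·∇_ν·G)` (p22's `B6Ineq2137GradKLevelV1`, α-uniform form = the staged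
`B6Cor28HolderKLevelV1.ineq2137_grad_kLevel_unif`) and `HasMajorant (P_{x,x′}·G·∇*_ν)` (p38, in progress), and the sup entries (2.136)₂ (p38's
`B6Prop26LapKLevelV1`, BY NAME) and (2.136)₃ (displayed, as in the (2.136) census).

HONEST FRAMING (programme rule): statement-level skeleton of published theorems with citation tags; proofs where landed; nothing here
is a claim about the Yang–Mills mass gap.

PRINT (verbatim, p. 247): «‖ζ∇GJ‖_α, ‖ζG∇*J‖_α ≤ O(1)(L^jη)^{1−α}(‖ζ‖^ξ_α + |ζ|)e^{−δ₃d(y,y′)}|J|, ξ = L^{−j} (2.137) for 0 ≤ α < 1, ζ ∈ C₀^∞(Δ̃(y))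
(the cube Δ̃(y) for y ∈ Λ_j is a sum of 2^d unit cubes on the L^{−j}-scale, having y as a corner), supp J ⊂ Δ(y′), with the constant O(1)
depending on d, L and α (O(1) → ∞ if α → 1)»; [4] (1.109) p. 35: «‖A‖_α = max_μ sup_{x,x′: |x−x′| ≤ 1} |x − x′|^{−α}|A_μ(x) − A_μ(x′)|».

## WHAT THIS FILE CERTIFIES (kernel-checked, sorry-free, standard axioms; THEOREMS ONLY)

* `holderQ_le_of_pair_entry` — THE HÖLDER QUOTIENT OF `ζ·F` FROM A PAIR BOUND AND AN ENTRY BOUND: if `|F(f)| ≤ Cm·ℓ_{y(f)}·E(y(f))` for every fine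
  bond and `|F(u) − F(u′)| ≤ Cm·t^α·ℓ_{y(u)}·E(y(u))` for every admissible ordered pair (`E(z) = e^{−δ d_T(z, y′)}`, `ℓ_z = len_T(z)·|c_f|⁻¹`), and
  `supp ζ` lies within torus distance 1 of the census site `y`, then `holderQ α ζ F ≤ 2·Cm·(L·e)·e^{δ}·ℓ_y^{1−α}·(‖ζ‖^ξ_α + |ζ|)·e^{−δ d_T(y, y′)}` — the
  product rule `B6HolderPairMemberV1.abs_cutoff_pair_le`, CASES on the support of `ζ` at the two points (both zero; `ζ(x) = 0 ≠ ζ(x′)`: the reversed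
  pair at the block of `x′`; `ζ(x) ≠ 0`: both terms at the block of `x`), the `t`-cancellation, and the move to the census site by (2.60)/(2.54)
  (`B6KLevelCensusBookkeepingV1.adjLen_rpow_le`/`exp_adj_le`) — NO cube geometry;
* **`prop26_census2137_kLevel_of_pairs`** — THE (2.137) CONJUNCT OF `B6.Ineq2136_2140` UNIFORMLY ON THE GENUINE k-LEVEL FAMILY
  (`∃ M₁ δ₃, ∃ Cα, 0 < M₁ ∧ 0 < δ₃ ∧ ∀ i, M₁ ≤ M → ∀ α J ζ y y′, 0 ≤ α → α < 1 → cutIn ζ y → suppIn J y′ →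
  (kG i).h1 J α ζ ≤ Cα α·(len y)^{1−α}·cutH α ζ·e^{−δ₃ dist y y′}·|J|`) from the displayed k-level inputs `hm1` (pair majorant of `∇_νG`, threshold
  before `α`), `hm2` (pair majorant of `G∇*_ν`, the same shape), `h3` ((2.136)₃ sup entry) and p38's `prop26_2136_lap_kLevel_unconditional` ((2.136)₂,
  BY NAME); witnesses: `M₁` = max of the four thresholds (`N + 1 ≤ R·L·M_h` covered since `R ≥ 1`), `δ₃` = min of the four rates,
  `Cα α = 2·Cm(α)·(L·e)·e^{δ₃}` with `Cm(α)` = max of the four constants (junk outside `[0,1)`).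

## HONEST SCOPE

(1) (2.137) ONLY, MODULO the displayed inputs `hm1`, `hm2`, `h3` (their providers: p22's H-chain / the staged `B6Cor28HolderKLevelV1.ineq2137_grad_kLevel_unif`;
p38's (2.137)₂ programme; p38's F13 re-packaged); (2.136)₂ is fed by name.  (2) Readings as in `B6KLevelCensusIndexV1`/`B6Prop26Census2136KLevelV1`:
admissibility = p22's symmetric pair condition, quotient `|x − x′|_phys^{−α}`, `‖ζ‖^ξ_α` at the scale of the first point's block, `supp ζ ⊂ Δ̃(y)` =
blocks within torus distance 1 of `y`.  (3) Constants depend on `d, L, α` AND the band.  THEOREMS ONLY; the displayed inputs are hypothesis binders.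
NOT summit progress.  Unit `lit-balaban-r03` (gen 26), 2026-08-24.
-/

noncomputable section

namespace Literature.MathematicalPhysics.QuantumFieldTheory.Balaban1983to89.B6Prop26Census2137KLevelV1

open LatticeFieldCalculus
open B6SectAOperatorsV1 (BondIdx)
open B6SectAVectorModelV1 (GE)
open B6Ineq2133TwoScaleV1 (onFun)
open B6RandomWalk (HasMajorant BlockSupp delta3 delta3_pos)
open B6MultiLevelBoxOperator (N0)
open B6MultiLevelTorusOperator (TDomains)
open B6GlobalChartV1 (PV domT blkV1)
open B6Geom246MultiLevelBox (bset)
open B6Geom246MultiLevelTorus (geomT)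
open B8Ineq192MultiLevelTorus (lenT_eq lenT_pos symmT)
open B6Prop26KLevelAssemblyV1 (distT_nonneg)
open B6CubeWindowV1 (Placed GlobalBand)
open B6Cover236MultiLevelBlocks (cubes)
open B6GradLegKLevelV1 (DV)
open B6LapLegKLevelV1 (DVa LapV)
open B6HolderPairMemberV1 (pairOp abs_cutoff_pair_le pairDiff_le_of_hasMajorant)
open B6Prop26LapKLevelV1 (prop26_2136_lap_kLevel_unconditional)
open B6KLevelCensusIndexV1 (KIdx Adm tpar kGeoG lenG_eq lenG_pos lenG_eq_geomT abs_le_supNormG supNormG_nonneg blockSupp_of_suppIn adm_symm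
  tpar_nonneg)
open B6KLevelCensusBookkeepingV1 (quot_cancel adjLen_rpow_le exp_adj_le eq_of_supDist_eq_zero)
open B6Prop26Census2136KLevelV1 (Gop supIn holderQ kG)
open B3TorusRadialSums (supDist_comm)

variable {d ℓ : ℕ} {hd : 1 ≤ d + 1} {hL : Odd (ℓ + 1) ∧ 1 < ℓ + 1} {b₀ b₁ : ℝ}

/-! ## §1  The Hölder quotient of `ζ·F` from a pair bound and an entry bound -/

open Classical in
/-- **THE HÖLDER QUOTIENT OF `ζ·F` FROM A PAIR BOUND AND AN ENTRY BOUND** (the common core of both members of (2.137)): for an index `i`, a census site `y`,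
a cut-off `ζ` supported within torus distance `1` of `y` with `|ζ| ≤ S₁` and `t^{−α}|ζ(u) − ζ(u′)| ≤ S₂` on admissible pairs, and a fine-bond function `F` with
ENTRY bound `|F(f)| ≤ Cm·ℓ_{y(f)}·e^{−δ d_T(y(f), w)}` and PAIR bound `|F(u) − F(u′)| ≤ Cm·t^α·ℓ_{y(u)}·e^{−δ d_T(y(u), w)}` on admissible pairs
(`ℓ_z = len_T(z)·|c_f|⁻¹`; `R·L·M_h ≥ 2L`):  `holderQ i α ζ F ≤ 2·Cm·(L·e)·e^{δ}·(ℓ_y)^{1−α}·(S₁ + S₂)·e^{−δ d_T(y, w)}`.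
[cite: Balaban1984PropagatorsII, (2.137) p.247, (2.54) p.232, (2.60) p.234; Balaban1984PropagatorsI, (1.109) p.35] -/
theorem holderQ_le_of_pair_entry (i : KIdx d ℓ hd hL b₀ b₁) {α : ℝ} (hα0 : 0 ≤ α) (hα1 : α < 1)
    (ζ F : PBond (PV d ℓ i.m i.K hd hL) 0 → ℝ) (y w : (geomT i.D).Site) {S1 S2 Cm δ : ℝ} (hS1 : 0 ≤ S1) (hS2 : 0 ≤ S2) (hCm : 0 ≤ Cm) (hδ : 0 ≤ δ)
    (hζ : ∀ f, ζ f ≠ 0 → (geomT i.D).dist (blkV1 i.hN i.D f) y ≤ 1)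
    (hζ1 : ∀ f, |ζ f| ≤ S1) (hζ2 : ∀ x x', Adm i x x' → tpar i x x' ^ (-α) * |ζ x - ζ x'| ≤ S2)
    (hEnt : ∀ f, |F f| ≤ Cm * ((geomT i.D).len (blkV1 i.hN i.D f) * |i.cf|⁻¹) * Real.exp (-(δ * (geomT i.D).dist (blkV1 i.hN i.D f) w)))
    (hPr : ∀ u u', Adm i u u' → |F u - F u'| ≤ Cm * (tpar i u u' ^ α * ((geomT i.D).len (blkV1 i.hN i.D u) * |i.cf|⁻¹)) *
      Real.exp (-(δ * (geomT i.D).dist (blkV1 i.hN i.D u) w))) :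
    holderQ i α ζ F ≤ 2 * Cm * (((ℓ : ℝ) + 1) * Real.exp 1) * Real.exp δ * ((geomT i.D).len y * |i.cf|⁻¹) ^ (1 - α) * (S1 + S2) *
      Real.exp (-(δ * (geomT i.D).dist y w)) := by
  have habs : 0 < |i.cf| := abs_pos.2 i.hcf
  have hMh1 : 1 ≤ i.Mh := le_trans (by norm_num) i.hM8
  have hP1 : ∀ μ, 1 ≤ i.P' μ := fun μ => le_trans (by norm_num) (i.hP5 μ)
  have hRM2L : 2 * (ℓ + 1) ≤ i.R * ((ℓ + 1) * i.Mh) := by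
    have h2 : 1 ≤ (ℓ + 1) * i.Mh := le_trans hMh1 (Nat.le_mul_of_pos_left _ (by omega))
    calc 2 * (ℓ + 1) ≤ 2 * (ℓ + 1) ^ 2 * 1 := by nlinarith
      _ ≤ i.R * ((ℓ + 1) * i.Mh) := Nat.mul_le_mul i.hR2 h2
  set ly : ℝ := (geomT i.D).len y * |i.cf|⁻¹ with hly
  have hly0 : 0 < ly := mul_pos (lenT_pos (D := i.D) y) (inv_pos.2 habs)
  set KL : ℝ := ((ℓ : ℝ) + 1) * Real.exp 1 with hKL
  have hKL0 : 0 ≤ KL := by positivity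
  have hRHS0 : 0 ≤ 2 * Cm * KL * Real.exp δ * ly ^ (1 - α) * (S1 + S2) * Real.exp (-(δ * (geomT i.D).dist y w)) := by positivity
  refine Real.iSup_le (fun q => ?_) hRHS0
  obtain ⟨x, x'⟩ := q
  simp only
  split_ifs with hadm
  swap
  · exact hRHS0
  obtain ⟨hdir, hs1, hs2⟩ := hadm
  have hadm' : Adm i x' x := adm_symm i ⟨hdir, hs1, hs2⟩
  -- the move from an adjacent block `z` to the census site `y`
  have hmove : ∀ z : (geomT i.D).Site, (geomT i.D).dist z y ≤ 1 →
      ((geomT i.D).len z * |i.cf|⁻¹) ^ (1 - α) * Real.exp (-(δ * (geomT i.D).dist z w)) ≤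
        KL * Real.exp δ * (ly ^ (1 - α) * Real.exp (-(δ * (geomT i.D).dist y w))) := by
    intro z hz
    have h1 := adjLen_rpow_le i.D hMh1 hP1 hRM2L i.hcf hα0 hα1.le y z hz
    have h2 := exp_adj_le i.D hMh1 hP1 hδ y z w hz
    have hEz0 : 0 ≤ Real.exp (-(δ * (geomT i.D).dist z w)) := (Real.exp_pos _).le
    calc ((geomT i.D).len z * |i.cf|⁻¹) ^ (1 - α) * Real.exp (-(δ * (geomT i.D).dist z w))
        ≤ (KL * ly ^ (1 - α)) * (Real.exp δ * Real.exp (-(δ * (geomT i.D).dist y w))) := mul_le_mul h1 h2 hEz0 (by positivity)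
      _ = _ := by ring
  -- the quotient factor `(s·η) = t·ℓ_u` for either end `u` of the pair
  have hquot : ∀ u : PBond (PV d ℓ i.m i.K hd hL) 0,
      (((supDist x.src x'.src : ℕ) : ℝ) * |i.cf|⁻¹) =
        (((supDist x.src x'.src : ℕ) : ℝ) / (((ℓ + 1 : ℕ) : ℝ)) ^ (blkV1 i.hN i.D u).1.1) * ((geomT i.D).len (blkV1 i.hN i.D u) * |i.cf|⁻¹) := by
    intro u
    rw [lenT_eq]
    have hLp : (0 : ℝ) < (((ℓ + 1 : ℕ) : ℝ)) ^ (blkV1 i.hN i.D u).1.1 := by positivity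
    have hc' : (((ℓ + 1 : ℕ) : ℝ)) = (ℓ : ℝ) + 1 := by push_cast; ring
    rw [hc'] at hLp ⊢
    field_simp
  -- the common final step at an adjacent block `z`
  have hfinal : ∀ z : (geomT i.D).Site, (geomT i.D).dist z y ≤ 1 →
      ∀ T : ℝ, T ≤ 2 * Cm * (S1 + S2) * (((geomT i.D).len z * |i.cf|⁻¹) ^ (1 - α) * Real.exp (-(δ * (geomT i.D).dist z w))) →
      T ≤ 2 * Cm * KL * Real.exp δ * ly ^ (1 - α) * (S1 + S2) * Real.exp (-(δ * (geomT i.D).dist y w)) := by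
    intro z hz T hT
    have hm := hmove z hz
    calc T ≤ 2 * Cm * (S1 + S2) * (KL * Real.exp δ * (ly ^ (1 - α) * Real.exp (-(δ * (geomT i.D).dist y w)))) :=
          hT.trans (mul_le_mul_of_nonneg_left hm (by positivity))
      _ = _ := by ring
  -- the degenerate pair
  rcases Nat.eq_zero_or_pos (supDist x.src x'.src) with hs0 | hspos
  · have hxx : x = x' := eq_of_supDist_eq_zero hdir hs0
    subst hxx
    simp only [sub_self, abs_zero, mul_zero]
    exact hRHS0
  have hsR : (0 : ℝ) < ((supDist x.src x'.src : ℕ) : ℝ) := by exact_mod_cast hspos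
  have htx : 0 < tpar i x x' := by unfold tpar; positivity
  have htx' : 0 < tpar i x' x := by unfold tpar; rw [supDist_comm]; positivity
  -- `ℓ_u^{−α}·ℓ_u = ℓ_u^{1−α}`
  have hpow : ∀ {l : ℝ}, 0 < l → l ^ (-α) * l = l ^ (1 - α) := by
    intro l hl
    rw [sub_eq_add_neg, Real.rpow_add hl, Real.rpow_one, mul_comm]
  by_cases hzx : ζ x = 0
  · by_cases hzx' : ζ x' = 0
    · rw [hzx, hzx']; simp only [zero_mul, sub_self, abs_zero, mul_zero]; exact hRHS0
    · -- `ζ(x) = 0 ≠ ζ(x′)`: the reversed pair `(x′, x)` at the block of `x′`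
      have hz' : (geomT i.D).dist (blkV1 i.hN i.D x') y ≤ 1 := hζ x' hzx'
      refine hfinal _ hz' _ ?_
      rw [hzx, zero_mul, zero_sub, abs_neg, abs_mul]
      have hζd : |ζ x'| ≤ tpar i x' x ^ α * S2 := by
        have h := hζ2 x' x hadm'
        rw [hzx, sub_zero] at h
        calc |ζ x'| = tpar i x' x ^ α * (tpar i x' x ^ (-α) * |ζ x'|) := by
              rw [← mul_assoc, Real.rpow_neg htx'.le, mul_inv_cancel₀ (Real.rpow_pos_of_pos htx' α).ne', one_mul]
          _ ≤ tpar i x' x ^ α * S2 := mul_le_mul_of_nonneg_left h (Real.rpow_nonneg htx'.le _)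
      have hq := hquot x'
      have hsc : supDist x'.src x.src = supDist x.src x'.src := supDist_comm _ _
      set lx' : ℝ := (geomT i.D).len (blkV1 i.hN i.D x') * |i.cf|⁻¹ with hlx'
      have hl0 : 0 < lx' := mul_pos (lenT_pos (D := i.D) _) (inv_pos.2 habs)
      set Ex' : ℝ := Real.exp (-(δ * (geomT i.D).dist (blkV1 i.hN i.D x') w)) with hEx'
      calc (((supDist x.src x'.src : ℕ) : ℝ) * |i.cf|⁻¹) ^ (-α) * (|ζ x'| * |F x'|)
          ≤ (((supDist x.src x'.src : ℕ) : ℝ) * |i.cf|⁻¹) ^ (-α) * ((tpar i x' x ^ α * S2) * (Cm * lx' * Ex')) :=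
            mul_le_mul_of_nonneg_left (mul_le_mul hζd (hEnt x') (abs_nonneg _) (by positivity)) (Real.rpow_nonneg (by positivity) _)
        _ = (tpar i x' x * lx') ^ (-α) * (tpar i x' x ^ α * (S2 * Cm * lx' * Ex')) := by
            rw [hq]; unfold tpar; rw [hsc]; ring
        _ = lx' ^ (-α) * (S2 * Cm * lx' * Ex') := quot_cancel htx' hl0.le
        _ = S2 * Cm * (lx' ^ (-α) * lx') * Ex' := by ring
        _ = S2 * Cm * lx' ^ (1 - α) * Ex' := by rw [hpow hl0]
        _ ≤ 2 * Cm * (S1 + S2) * (lx' ^ (1 - α) * Ex') := by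
            have hA0 : 0 ≤ lx' ^ (1 - α) * Ex' := by positivity
            have : S2 * Cm ≤ 2 * Cm * (S1 + S2) := by nlinarith
            calc S2 * Cm * lx' ^ (1 - α) * Ex' = (S2 * Cm) * (lx' ^ (1 - α) * Ex') := by ring
              _ ≤ _ := mul_le_mul_of_nonneg_right this hA0
  · -- `ζ(x) ≠ 0`: the product rule, both terms at the block of `x`
    have hz : (geomT i.D).dist (blkV1 i.hN i.D x) y ≤ 1 := hζ x hzx
    refine hfinal _ hz _ ?_
    have hprod := abs_cutoff_pair_le ζ F x x'
    have hζd : |ζ x - ζ x'| ≤ tpar i x x' ^ α * S2 := by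
      have h := hζ2 x x' ⟨hdir, hs1, hs2⟩
      calc |ζ x - ζ x'| = tpar i x x' ^ α * (tpar i x x' ^ (-α) * |ζ x - ζ x'|) := by
            rw [← mul_assoc, Real.rpow_neg htx.le, mul_inv_cancel₀ (Real.rpow_pos_of_pos htx α).ne', one_mul]
        _ ≤ tpar i x x' ^ α * S2 := mul_le_mul_of_nonneg_left h (Real.rpow_nonneg htx.le _)
    have hq := hquot x
    set lx : ℝ := (geomT i.D).len (blkV1 i.hN i.D x) * |i.cf|⁻¹ with hlx
    have hl0 : 0 < lx := mul_pos (lenT_pos (D := i.D) _) (inv_pos.2 habs)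
    set Ex : ℝ := Real.exp (-(δ * (geomT i.D).dist (blkV1 i.hN i.D x) w)) with hEx
    have hT1 : |ζ x'| * |F x - F x'| ≤ S1 * (Cm * (tpar i x x' ^ α * lx) * Ex) :=
      mul_le_mul (hζ1 x') (hPr x x' ⟨hdir, hs1, hs2⟩) (abs_nonneg _) hS1
    have hT2 : |ζ x - ζ x'| * |F x| ≤ (tpar i x x' ^ α * S2) * (Cm * lx * Ex) :=
      mul_le_mul hζd (hEnt x) (abs_nonneg _) (by positivity)
    calc (((supDist x.src x'.src : ℕ) : ℝ) * |i.cf|⁻¹) ^ (-α) * |ζ x * F x - ζ x' * F x'|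
        ≤ (((supDist x.src x'.src : ℕ) : ℝ) * |i.cf|⁻¹) ^ (-α) * (S1 * (Cm * (tpar i x x' ^ α * lx) * Ex) + (tpar i x x' ^ α * S2) * (Cm * lx * Ex)) :=
          mul_le_mul_of_nonneg_left (hprod.trans (add_le_add hT1 hT2)) (Real.rpow_nonneg (by positivity) _)
      _ = (tpar i x x' * lx) ^ (-α) * (tpar i x x' ^ α * ((S1 + S2) * Cm * lx * Ex)) := by
          rw [hq]; unfold tpar; ring
      _ = lx ^ (-α) * ((S1 + S2) * Cm * lx * Ex) := quot_cancel htx hl0.le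
      _ = (S1 + S2) * Cm * (lx ^ (-α) * lx) * Ex := by ring
      _ = (S1 + S2) * Cm * lx ^ (1 - α) * Ex := by rw [hpow hl0]
      _ ≤ 2 * Cm * (S1 + S2) * (lx ^ (1 - α) * Ex) := by
          have hA0 : 0 ≤ lx ^ (1 - α) * Ex := by positivity
          have : (S1 + S2) * Cm ≤ 2 * Cm * (S1 + S2) := by nlinarith
          calc (S1 + S2) * Cm * lx ^ (1 - α) * Ex = ((S1 + S2) * Cm) * (lx ^ (1 - α) * Ex) := by ring
            _ ≤ _ := mul_le_mul_of_nonneg_right this hA0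

/-! ## §2  The (2.137) conjunct of the census, uniformly on the family, from the displayed k-level inputs -/

open Classical in
/-- **[B6] PROPOSITION 2.6 (2.137), THE SECOND CONJUNCT OF `B6.Prop26Printed`'s `Ineq2136_2140`, ON THE GENUINE k-LEVEL V1 FAMILY, MODULO ITS
k-LEVEL INPUTS**: `‖ζ∇GJ‖_α, ‖ζG∇*J‖_α ≤ C(α)(Lʲη)^{1−α}(‖ζ‖^ξ_α + |ζ|)e^{−δ₃d(y,y′)}|J|` for `supp ζ ⊂ Δ̃(y)`, `supp J ⊂ Δ(y′)`, `0 ≤ α < 1`, with ONE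
threshold `M₁ ≤ M` and ONE rate for the whole family and all `α`, from: `hm1` = the pair majorant of `∇_νG` (p22's (2.137)₁ at k levels, threshold
before `α`: the statement of `B6Cor28HolderKLevelV1.ineq2137_grad_kLevel_unif` in `∃δ`-form), `hm2` = the pair majorant of `G∇*_ν` (the same shape;
p38's (2.137)₂ programme), `h3` = the sup entry (2.136)₃ (as in `B6Prop26Census2136KLevelV1.prop26_census2136_kLevel_of_div`), and p38's
`B6Prop26LapKLevelV1.prop26_2136_lap_kLevel_unconditional` ((2.136)₂, BY NAME).
[cite: Balaban1984PropagatorsII, Prop. 2.6 (2.137) p.247, (2.136) p.247, (2.141) p.247, (2.54) p.232, (2.60) p.234; Balaban1984PropagatorsI, (1.109) p.35] -/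
theorem prop26_census2137_kLevel_of_pairs (hb₀ : 0 < b₀) (hb₁ : b₀ ≤ b₁)
    (hm1 : ∃ (δ M₂ : ℝ) (N₁ : ℕ), 0 < δ ∧ 0 < M₂ ∧ ∀ (α : ℝ), 0 ≤ α → α < 1 → ∃ A : ℝ, 0 ≤ A ∧
      ∀ (m K : ℕ) {Mh k R : ℕ} {P' : Fin (d + 1) → ℕ}
        (hN : ∀ μ, N0 ℓ Mh k P' μ = (PV d ℓ m K hd hL).sitesPerDir 0) (D : TDomains d ℓ Mh k P' R) (hk : k ≤ m + K) (_ : 2 ≤ k)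
        {a : ℕ} (_ : Mh = (ℓ + 1) ^ a) (_ : 8 ≤ Mh) (_ : 2 * (ℓ + 1) ^ 2 ≤ R) (_ : ∀ μ, 5 ≤ P' μ) (_ : 4 ≤ ℓ)
        (_ : ∀ c : ↥(cubes D.toDomains), Placed ℓ k P' c.1) (_ : M₂ ≤ ((ℓ : ℝ) + 1) * Mh) (_ : N₁ + 1 ≤ R * ((ℓ + 1) * Mh))
        {cf : ℝ} (hcf : cf ≠ 0) {w : BondIdx (domT hN D hk) → ℝ} (hw : ∀ i, 0 < w i) (_ : GlobalBand b₀ b₁ cf w)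
        (ν : Fin (d + 1)) (x x' : PBond (PV d ℓ m K hd hL) 0), x.dir = x'.dir →
        supDist x.src x'.src ≤ (ℓ + 1) ^ (blkV1 hN D x).1.1 → supDist x.src x'.src ≤ (ℓ + 1) ^ (blkV1 hN D x').1.1 →
        HasMajorant (g := geomT D) (blkV1 hN D) (pairOp x x' * DV (P := PV d ℓ m K hd hL) ν cf * onFun (GE (domT hN D hk) hcf hw))
          (fun y y' => A * ((((supDist x.src x'.src : ℕ) : ℝ) / (((ℓ + 1 : ℕ) : ℝ)) ^ (blkV1 hN D x).1.1) ^ α *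
            ((geomT D).len y * |cf|⁻¹)) * Real.exp (-(δ * (geomT D).dist y y'))))
    (hm2 : ∃ (δ M₂ : ℝ) (N₁ : ℕ), 0 < δ ∧ 0 < M₂ ∧ ∀ (α : ℝ), 0 ≤ α → α < 1 → ∃ A : ℝ, 0 ≤ A ∧
      ∀ (m K : ℕ) {Mh k R : ℕ} {P' : Fin (d + 1) → ℕ}
        (hN : ∀ μ, N0 ℓ Mh k P' μ = (PV d ℓ m K hd hL).sitesPerDir 0) (D : TDomains d ℓ Mh k P' R) (hk : k ≤ m + K) (_ : 2 ≤ k)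
        {a : ℕ} (_ : Mh = (ℓ + 1) ^ a) (_ : 8 ≤ Mh) (_ : 2 * (ℓ + 1) ^ 2 ≤ R) (_ : ∀ μ, 5 ≤ P' μ) (_ : 4 ≤ ℓ)
        (_ : ∀ c : ↥(cubes D.toDomains), Placed ℓ k P' c.1) (_ : M₂ ≤ ((ℓ : ℝ) + 1) * Mh) (_ : N₁ + 1 ≤ R * ((ℓ + 1) * Mh))
        {cf : ℝ} (hcf : cf ≠ 0) {w : BondIdx (domT hN D hk) → ℝ} (hw : ∀ i, 0 < w i) (_ : GlobalBand b₀ b₁ cf w)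
        (ν : Fin (d + 1)) (x x' : PBond (PV d ℓ m K hd hL) 0), x.dir = x'.dir →
        supDist x.src x'.src ≤ (ℓ + 1) ^ (blkV1 hN D x).1.1 → supDist x.src x'.src ≤ (ℓ + 1) ^ (blkV1 hN D x').1.1 →
        HasMajorant (g := geomT D) (blkV1 hN D) (pairOp x x' * onFun (GE (domT hN D hk) hcf hw) * DVa ν cf)
          (fun y y' => A * ((((supDist x.src x'.src : ℕ) : ℝ) / (((ℓ + 1 : ℕ) : ℝ)) ^ (blkV1 hN D x).1.1) ^ α *
            ((geomT D).len y * |cf|⁻¹)) * Real.exp (-(δ * (geomT D).dist y y'))))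
    (h3 : ∃ (δ A M₂ : ℝ) (N₁ : ℕ), 0 < δ ∧ 0 ≤ A ∧ 0 < M₂ ∧
      ∀ (m K : ℕ) {Mh k R : ℕ} {P' : Fin (d + 1) → ℕ}
        (hN : ∀ μ, N0 ℓ Mh k P' μ = (PV d ℓ m K hd hL).sitesPerDir 0) (D : TDomains d ℓ Mh k P' R) (hk : k ≤ m + K) (_ : 2 ≤ k)
        {a : ℕ} (_ : Mh = (ℓ + 1) ^ a) (_ : 8 ≤ Mh) (_ : 2 * (ℓ + 1) ^ 2 ≤ R) (_ : ∀ μ, 5 ≤ P' μ) (_ : 4 ≤ ℓ)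
        (_ : ∀ c : ↥(cubes D.toDomains), Placed ℓ k P' c.1) (_ : M₂ ≤ ((ℓ : ℝ) + 1) * Mh) (_ : N₁ + 1 ≤ R * ((ℓ + 1) * Mh))
        {cf : ℝ} (hcf : cf ≠ 0) {w : BondIdx (domT hN D hk) → ℝ} (hw : ∀ i, 0 < w i) (_ : GlobalBand b₀ b₁ cf w) (ν : Fin (d + 1)),
        HasMajorant (g := geomT D) (blkV1 hN D) (onFun (GE (domT hN D hk) hcf hw) ∘ₗ DVa ν cf)
          (fun y y' => A * ((geomT D).len y * |cf|⁻¹) * Real.exp (-(δ * (geomT D).dist y y')))) :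
    ∃ M₁ δ₃ : ℝ, ∃ Cα : ℝ → ℝ, 0 < M₁ ∧ 0 < δ₃ ∧ ∀ i : KIdx d ℓ hd hL b₀ b₁, M₁ ≤ (kGeoG i).M →
      ∀ (α : ℝ) (J : (kGeoG i).Loc) (ζ : (kGeoG i).Cut) (y y' : (kGeoG i).Site), 0 ≤ α → α < 1 →
        (kGeoG i).cutIn ζ y → (kGeoG i).suppIn J y' →
        (kG i).h1 J α ζ ≤ Cα α * (kGeoG i).len y ^ (1 - α) * (kGeoG i).cutH α ζ * Real.exp (-(δ₃ * (kGeoG i).dist y y')) *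
          (kGeoG i).supNorm J := by
  -- the four inputs
  obtain ⟨σ₁, hσ₁, hF⟩ := prop26_2136_lap_kLevel_unconditional d ℓ hd hL hb₀ hb₁
  obtain ⟨A₀, M₀, hA₀, hM₀, hF2⟩ := hF σ₁ hσ₁ le_rfl (1 / 2) (by norm_num) (by norm_num)
  clear hF
  have hδ₀ : 0 < delta3 (1 / 2) (2 * σ₁) := delta3_pos (by norm_num) (by linarith)
  obtain ⟨δ₁, M₁', N₁, hδ₁, hM₁', hP1⟩ := hm1
  obtain ⟨δ₂, M₂', N₂, hδ₂, hM₂', hP2⟩ := hm2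
  obtain ⟨δ₃', A₃, M₃, N₃, hδ₃', hA₃, hM₃, hE3⟩ := h3
  set δ₃ : ℝ := min (min (delta3 (1 / 2) (2 * σ₁)) δ₃') (min δ₁ δ₂) with hδ₃_def
  have hδ₃ : 0 < δ₃ := lt_min (lt_min hδ₀ hδ₃') (lt_min hδ₁ hδ₂)
  have hδ₃a : δ₃ ≤ delta3 (1 / 2) (2 * σ₁) := (min_le_left _ _).trans (min_le_left _ _)
  have hδ₃b : δ₃ ≤ δ₃' := (min_le_left _ _).trans (min_le_right _ _)
  have hδ₃c : δ₃ ≤ δ₁ := (min_le_right _ _).trans (min_le_left _ _)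
  have hδ₃d : δ₃ ≤ δ₂ := (min_le_right _ _).trans (min_le_right _ _)
  -- the pair constants as functions of `α` (junk outside `[0,1)`)
  set A1 : ℝ → ℝ := fun α => if h : 0 ≤ α ∧ α < 1 then Classical.choose (hP1 α h.1 h.2) else 0 with hA1def
  set A2 : ℝ → ℝ := fun α => if h : 0 ≤ α ∧ α < 1 then Classical.choose (hP2 α h.1 h.2) else 0 with hA2def
  have hA1_0 : ∀ α, 0 ≤ A1 α := by
    intro α; simp only [hA1def]; split_ifs with h
    · exact (Classical.choose_spec (hP1 α h.1 h.2)).1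
    · exact le_rfl
  have hA2_0 : ∀ α, 0 ≤ A2 α := by
    intro α; simp only [hA2def]; split_ifs with h
    · exact (Classical.choose_spec (hP2 α h.1 h.2)).1
    · exact le_rfl
  set KL : ℝ := ((ℓ : ℝ) + 1) * Real.exp 1 with hKL
  set Cm : ℝ → ℝ := fun α => max (max (A1 α) (A2 α)) (max A₀ A₃) with hCmdef
  have hCm0 : ∀ α, 0 ≤ Cm α := fun α => hA₀.trans ((le_max_left _ _).trans (le_max_right _ _))
  refine ⟨max (max (max M₀ M₃) (max M₁' M₂')) (max (max ((N₁ : ℝ) + 1) ((N₂ : ℝ) + 1)) ((N₃ : ℝ) + 1)), δ₃,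
    fun α => 2 * Cm α * KL * Real.exp δ₃, ?_, hδ₃, fun i hM α J ζ y y' hα0 hα1 hζ hJ => ?_⟩
  · exact lt_max_of_lt_left (lt_max_of_lt_left (lt_max_of_lt_left hM₀))
  -- thresholds of the index
  have hM' : max (max (max M₀ M₃) (max M₁' M₂')) (max (max ((N₁ : ℝ) + 1) ((N₂ : ℝ) + 1)) ((N₃ : ℝ) + 1)) ≤ (((ℓ + 1 : ℕ) : ℝ)) * (i.Mh : ℝ) := hM
  have hcast : (((ℓ + 1 : ℕ) : ℝ)) = (ℓ : ℝ) + 1 := by push_cast; ring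
  have hthrM : ∀ {M : ℝ}, M ≤ max (max M₀ M₃) (max M₁' M₂') → M ≤ ((ℓ : ℝ) + 1) * i.Mh :=
    fun h => by rw [← hcast]; exact (h.trans (le_max_left _ _)).trans hM'
  have hM0i : M₀ ≤ ((ℓ : ℝ) + 1) * i.Mh := hthrM ((le_max_left _ _).trans (le_max_left _ _))
  have hM3i : M₃ ≤ ((ℓ : ℝ) + 1) * i.Mh := hthrM ((le_max_right _ _).trans (le_max_left _ _))
  have hM1i : M₁' ≤ ((ℓ : ℝ) + 1) * i.Mh := hthrM ((le_max_left _ _).trans (le_max_right _ _))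
  have hM2i : M₂' ≤ ((ℓ : ℝ) + 1) * i.Mh := hthrM ((le_max_right _ _).trans (le_max_right _ _))
  have hR1 : 1 ≤ i.R := le_trans (Nat.one_le_two_pow) (le_trans (Nat.pow_le_pow_left (by omega : 2 ≤ ℓ + 1) 2 |>.trans
    (Nat.le_mul_of_pos_left _ (by norm_num))) i.hR2)
  have hthrN : ∀ {N : ℕ}, ((N : ℝ) + 1) ≤ max (max ((N₁ : ℝ) + 1) ((N₂ : ℝ) + 1)) ((N₃ : ℝ) + 1) → N + 1 ≤ i.R * ((ℓ + 1) * i.Mh) := by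
    intro N h
    have h1 : ((N : ℝ) + 1) ≤ (((ℓ + 1 : ℕ) : ℝ)) * (i.Mh : ℝ) := (h.trans (le_max_right _ _)).trans hM'
    have h2 : N + 1 ≤ (ℓ + 1) * i.Mh := by exact_mod_cast h1
    exact h2.trans (Nat.le_mul_of_pos_left _ hR1)
  have hN1i : N₁ + 1 ≤ i.R * ((ℓ + 1) * i.Mh) := hthrN ((le_max_left _ _).trans (le_max_left _ _))
  have hN2i : N₂ + 1 ≤ i.R * ((ℓ + 1) * i.Mh) := hthrN ((le_max_right _ _).trans (le_max_left _ _))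
  have hN3i : N₃ + 1 ≤ i.R * ((ℓ + 1) * i.Mh) := hthrN (le_max_right _ _)
  -- the inputs at the index
  obtain ⟨-, hE1, -⟩ := hF2 i.m i.K i.hN i.D i.hk i.hk2 i.hMha i.hM8 i.hR2 i.hP5 i.hℓ i.hpl hM0i i.hcf i.hw i.hwb
  have hE2 := fun ν => hE3 i.m i.K i.hN i.D i.hk i.hk2 i.hMha i.hM8 i.hR2 i.hP5 i.hℓ i.hpl hM3i hN3i i.hcf i.hw i.hwb ν
  have hspec1 := Classical.choose_spec (hP1 α hα0 hα1)
  have hspec2 := Classical.choose_spec (hP2 α hα0 hα1)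
  have hA1eq : A1 α = Classical.choose (hP1 α hα0 hα1) := by simp only [hA1def, dif_pos (And.intro hα0 hα1)]
  have hA2eq : A2 α = Classical.choose (hP2 α hα0 hα1) := by simp only [hA2def, dif_pos (And.intro hα0 hα1)]
  rw [← hA1eq] at hspec1
  rw [← hA2eq] at hspec2
  obtain ⟨-, hQ1⟩ := hspec1
  obtain ⟨-, hQ2⟩ := hspec2
  have hPair1 := hQ1 i.m i.K i.hN i.D i.hk i.hk2 i.hMha i.hM8 i.hR2 i.hP5 i.hℓ i.hpl hM1i hN1i i.hcf i.hw i.hwb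
  have hPair2 := hQ2 i.m i.K i.hN i.D i.hk i.hk2 i.hMha i.hM8 i.hR2 i.hP5 i.hℓ i.hpl hM2i hN2i i.hcf i.hw i.hwb
  clear hQ1 hQ2 hE3 hF2
  -- `J`: «supp J ⊂ Δ(y′)», `|J| = B`
  have hBS := blockSupp_of_suppIn i hJ
  set B : ℝ := (kGeoG i).supNorm J with hB_def
  have hB : 0 ≤ B := supNormG_nonneg i J
  -- the cut-off readings
  set S1 : ℝ := ⨆ f : PBond (PV d ℓ i.m i.K hd hL) 0, |ζ f| with hS1
  set S2 : ℝ := ⨆ q : PBond (PV d ℓ i.m i.K hd hL) 0 × PBond (PV d ℓ i.m i.K hd hL) 0,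
    if Adm i q.1 q.2 then tpar i q.1 q.2 ^ (-α) * |ζ q.1 - ζ q.2| else 0 with hS2
  have hS1_0 : 0 ≤ S1 := Real.iSup_nonneg fun f => abs_nonneg _
  have hS2_0 : 0 ≤ S2 := Real.iSup_nonneg fun q => by
    split_ifs
    · exact mul_nonneg (Real.rpow_nonneg (tpar_nonneg i _ _) _) (abs_nonneg _)
    · exact le_rfl
  have hcutH : (kGeoG i).cutH α ζ = S1 + S2 := rfl
  have hζ1 : ∀ f, |ζ f| ≤ S1 := fun f => le_ciSup (f := fun f => |ζ f|) (Set.finite_range _).bddAbove f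
  have hζ2 : ∀ x x', Adm i x x' → tpar i x x' ^ (-α) * |ζ x - ζ x'| ≤ S2 := by
    intro x x' hadm
    have := le_ciSup (f := fun q : PBond (PV d ℓ i.m i.K hd hL) 0 × PBond (PV d ℓ i.m i.K hd hL) 0 =>
      if Adm i q.1 q.2 then tpar i q.1 q.2 ^ (-α) * |ζ q.1 - ζ q.2| else 0) (Set.finite_range _).bddAbove (x, x')
    simp only [if_pos hadm] at this
    exact this
  have hζ' : ∀ f, ζ f ≠ 0 → (geomT i.D).dist (blkV1 i.hN i.D f) y ≤ 1 := hζ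
  -- common
  have habs : 0 < |i.cf| := abs_pos.2 i.hcf
  set ly : ℝ := (geomT i.D).len y * |i.cf|⁻¹ with hly
  have hlyG : (kGeoG i).len y = ly := lenG_eq_geomT i y
  have hd0 : 0 ≤ (geomT i.D).dist y y' := distT_nonneg y y'
  have hrate : ∀ {δ : ℝ} (_ : δ₃ ≤ δ) (z : (geomT i.D).Site), Real.exp (-(δ * (geomT i.D).dist z y')) ≤ Real.exp (-(δ₃ * (geomT i.D).dist z y')) :=
    fun hδ z => Real.exp_le_exp.2 (neg_le_neg (mul_le_mul_of_nonneg_right hδ (distT_nonneg z y')))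
  -- THE TARGET: `max (⨆ ν, holderQ … (∇_νGJ)) (⨆ ν, holderQ … (G∇*_νJ)) ≤ 2·Cm·KL·e^{δ₃}·ly^{1−α}·(S1+S2)·e^{−δ₃ d}·B`
  rw [hcutH, hlyG]
  show max (⨆ ν : Fin (d + 1), holderQ i α ζ ((DV ν i.cf ∘ₗ Gop i) J)) (⨆ ν : Fin (d + 1), holderQ i α ζ ((Gop i ∘ₗ DVa ν i.cf) J)) ≤
    2 * Cm α * KL * Real.exp δ₃ * ly ^ (1 - α) * (S1 + S2) * Real.exp (-(δ₃ * (geomT i.D).dist y y')) * B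
  have hgoal : ∀ (F : Fin (d + 1) → (PBond (PV d ℓ i.m i.K hd hL) 0 → ℝ)),
      (∀ ν f, |F ν f| ≤ Cm α * (((geomT i.D).len (blkV1 i.hN i.D f) * |i.cf|⁻¹)) * Real.exp (-(δ₃ * (geomT i.D).dist (blkV1 i.hN i.D f) y')) * B) →
      (∀ ν u u', Adm i u u' → |F ν u - F ν u'| ≤ Cm α * (tpar i u u' ^ α * ((geomT i.D).len (blkV1 i.hN i.D u) * |i.cf|⁻¹)) *
        Real.exp (-(δ₃ * (geomT i.D).dist (blkV1 i.hN i.D u) y')) * B) →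
      (⨆ ν, holderQ i α ζ (F ν)) ≤ 2 * Cm α * KL * Real.exp δ₃ * ly ^ (1 - α) * (S1 + S2) * Real.exp (-(δ₃ * (geomT i.D).dist y y')) * B := by
    intro F hEnt hPr
    have hRHS0 : 0 ≤ 2 * Cm α * KL * Real.exp δ₃ * ly ^ (1 - α) * (S1 + S2) * Real.exp (-(δ₃ * (geomT i.D).dist y y')) * B := by
      have := hCm0 α; have : 0 < ly := mul_pos (lenT_pos (D := i.D) y) (inv_pos.2 habs); positivity
    refine Real.iSup_le (fun ν => ?_) hRHS0
    -- scale out `B`: apply §1 with `Cm·B`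
    have hCmB : 0 ≤ Cm α * B := mul_nonneg (hCm0 α) hB
    have h := holderQ_le_of_pair_entry i hα0 hα1 ζ (F ν) y y' hS1_0 hS2_0 hCmB hδ₃.le hζ' hζ1 hζ2
      (fun f => (hEnt ν f).trans (le_of_eq (by ring))) (fun u u' hadm => (hPr ν u u' hadm).trans (le_of_eq (by ring)))
    calc holderQ i α ζ (F ν) ≤ 2 * (Cm α * B) * (((ℓ : ℝ) + 1) * Real.exp 1) * Real.exp δ₃ * ((geomT i.D).len y * |i.cf|⁻¹) ^ (1 - α) * (S1 + S2) *
          Real.exp (-(δ₃ * (geomT i.D).dist y y')) := h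
      _ = _ := by rw [hKL, hly]; ring
  refine max_le ?_ ?_
  · -- member 1: `‖ζ∇GJ‖_α`
    refine hgoal (fun ν => (DV ν i.cf ∘ₗ Gop i) J) (fun ν f => ?_) (fun ν u u' hadm => ?_)
    · have h : |(DV ν i.cf ∘ₗ Gop i) J f| ≤ A₀ * ((geomT i.D).len (blkV1 i.hN i.D f) * |i.cf|⁻¹) *
          Real.exp (-(delta3 (1 / 2) (2 * σ₁) * (geomT i.D).dist (blkV1 i.hN i.D f) y')) * B := hE1 ν y' J B hBS f
      have hl0 : 0 ≤ (geomT i.D).len (blkV1 i.hN i.D f) * |i.cf|⁻¹ := mul_nonneg (lenT_pos (D := i.D) _).le (inv_nonneg.2 habs.le)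
      refine h.trans (mul_le_mul_of_nonneg_right ?_ hB)
      exact mul_le_mul (mul_le_mul_of_nonneg_right ((le_max_left _ _).trans (le_max_right _ _)) hl0) (hrate hδ₃a _)
        (Real.exp_pos _).le (mul_nonneg (hCm0 α) hl0)
    · obtain ⟨hd', h1', h2'⟩ := hadm
      have hmaj := hPair1 ν u u' hd' h1' h2'
      rw [mul_assoc] at hmaj
      have h := pairDiff_le_of_hasMajorant (g := geomT i.D) (blkV1 i.hN i.D) u u' hmaj y' J B hBS
      have hl0 : 0 ≤ tpar i u u' ^ α * ((geomT i.D).len (blkV1 i.hN i.D u) * |i.cf|⁻¹) :=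
        mul_nonneg (Real.rpow_nonneg (tpar_nonneg i _ _) _) (mul_nonneg (lenT_pos (D := i.D) _).le (inv_nonneg.2 habs.le))
      refine h.trans (mul_le_mul_of_nonneg_right ?_ hB)
      exact mul_le_mul (mul_le_mul_of_nonneg_right ((le_max_left _ _).trans (le_max_left _ _)) hl0) (hrate hδ₃c _)
        (Real.exp_pos _).le (mul_nonneg (hCm0 α) hl0)
  · -- member 2: `‖ζG∇*J‖_α`
    refine hgoal (fun ν => (Gop i ∘ₗ DVa ν i.cf) J) (fun ν f => ?_) (fun ν u u' hadm => ?_)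
    · have h : |(Gop i ∘ₗ DVa ν i.cf) J f| ≤ A₃ * ((geomT i.D).len (blkV1 i.hN i.D f) * |i.cf|⁻¹) *
          Real.exp (-(δ₃' * (geomT i.D).dist (blkV1 i.hN i.D f) y')) * B := hE2 ν y' J B hBS f
      have hl0 : 0 ≤ (geomT i.D).len (blkV1 i.hN i.D f) * |i.cf|⁻¹ := mul_nonneg (lenT_pos (D := i.D) _).le (inv_nonneg.2 habs.le)
      refine h.trans (mul_le_mul_of_nonneg_right ?_ hB)
      exact mul_le_mul (mul_le_mul_of_nonneg_right ((le_max_right _ _).trans (le_max_right _ _)) hl0) (hrate hδ₃b _)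
        (Real.exp_pos _).le (mul_nonneg (hCm0 α) hl0)
    · obtain ⟨hd', h1', h2'⟩ := hadm
      have hmaj := hPair2 ν u u' hd' h1' h2'
      rw [mul_assoc] at hmaj
      have h := pairDiff_le_of_hasMajorant (g := geomT i.D) (blkV1 i.hN i.D) u u' hmaj y' J B hBS
      have hl0 : 0 ≤ tpar i u u' ^ α * ((geomT i.D).len (blkV1 i.hN i.D u) * |i.cf|⁻¹) :=
        mul_nonneg (Real.rpow_nonneg (tpar_nonneg i _ _) _) (mul_nonneg (lenT_pos (D := i.D) _).le (inv_nonneg.2 habs.le))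
      refine h.trans (mul_le_mul_of_nonneg_right ?_ hB)
      exact mul_le_mul (mul_le_mul_of_nonneg_right ((le_max_right _ _).trans (le_max_left _ _)) hl0) (hrate hδ₃d _)
        (Real.exp_pos _).le (mul_nonneg (hCm0 α) hl0)

end Literature.MathematicalPhysics.QuantumFieldTheory.Balaban1983to89.B6Prop26Census2137KLevelV1

end
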